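import Mathlib
import Literature.NumberTheory.LFunctions.Zhang2022.Section10cMid1214Int
import Literature.NumberTheory.LFunctions.Zhang2022.Section18MainSumsLamAvg
import Literature.NumberTheory.LFunctions.Zhang2022.Section10MainTerms
import HarnessLib

/-!
# Zhang (2022) §18, proof of (2.33): the «second lines» of the two window displays of p. 100 —
# `main18u010`, `main18u011b` pass to their `z`-integrals, and `α⁻¹S_j(𝐚₂₃,𝐚₂₃) = d₇ⱼ𝔞` at main order

Topic `Literature/NumberTheory/LFunctions/Zhang2022` (Landau–Siegel audit tree; verdict-neutral).
Y. Zhang, *Discrete mean estimates and the Landau–Siegel zero*, arXiv:2211.02515v1 (2022)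
[Zhang2022LandauSiegel], §18 p. 100 (tex L4932–L4946), the two displayed range evaluations of
`S_j(𝐚₂₃,𝐚₂₃)`: "the sum over `P^{0.5} ≤ dr < P^{0.502}` is equal to
`(500L′(1,χ)/log P)² Σ_{P^{0.5} ≤ n < P^{0.502}} |χ(n)|λ₀ⱼ(n)/φ(n)(−1 − β_j log(n/P^{0.5}))(−1 + 𝒴₁ⱼ(n)) + o(α)`"
and its twin on `[P^{0.502}, P^{0.504})` with `(1 − β_j log(P^{0.504}/n))(1 + 𝒴₂ⱼ(n))` — **an unrefereed
manuscript under adjudication; nothing here asserts its Theorems 1–2.** Lane ZHANG-L (strike seat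
zl-closer-2), ruling R-35 / RT-08: the terminal theorem of record `theorem1_of_sec18E` takes the §18
estimate E-105 `MainOrderContradiction (c232E e1ppD) C233`, whose second constant `C233 =
2Re{½d₇₁ + 2d₇₂ + 3⁄2d₇₃}` (`Section10Defs.C233`) is the SHARP main-term constant of (18.3); the landed
§18 chain (`Skeleton.ded183RelW_holds`, Section18RangeEdgesRelW) only reaches the printed CRUDE
constant `8800/π` through the one-sided bound u013/u014. This file supplies the missing §10-type
"second line" for the two §18 windows — the manuscript's own evaluation rule of §8/§10 ("By the
discussion in Section 8 and 10") applied to the displayed `n`-sums — with NO manuscript claim as a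
hypothesis except Assumption (A) carried by the tree theorems `Typed.Sec10A.step10u023_holds` /
`step10u024_holds` (which are typed under (A)):

* (piece (a), imported: zl-w10-p1's `Section18MainSumsLamAvg.main18u010_eq_lamAvg` /
  `main18u011b_eq_lamAvg` — the two displayed main terms ARE `250000·L′(1,χ)²/log²P · lamAvg` of the
  profiles `F₁(t) = (−1 − β_j log(t/P^{0.5}))(−1 + 𝒴₁ⱼ(t))`, `F₂(t) = (1 − β_j log(P^{0.504}/t))(1 + 𝒴₂ⱼ(t))`);
* `linFactor1_bounds`, `linFactor2_bounds`, `scaled_bounds`, `profile1_bounds`, `profile2_bounds` —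
  the profiles are `C¹` on `[1, P]` with `‖F₁‖ ≤ 7089`, `‖F₁′‖ ≤ 5068α/t`, `‖F₂‖ ≤ 2737`,
  `‖F₂′‖ ≤ 1868α/t` (product rule over the tree's `y1Profile_bounds` / `y2Profile_bounds`, §10);
* **`main18u010_secondLine`, `main18u011b_secondLine`** — for every `ε > 0`, all large `D`, (A),
  `j ∈ {1,2,3}`: `‖main18u010 − (250000𝔞/log P)∫_{0.5}^{0.502}(−1 − πij(z−0.5))(−1 + 𝔶𝔶₁ⱼ(z))dz‖ ≤ εα`
  and `‖main18u011b − (250000𝔞/log P)∫_{0.502}^{0.504}(1 − πij(0.504−z))(1 + 𝔶𝔶₂ⱼ(z))dz‖ ≤ εα`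
  (engine: `Typed.Sec10C.lamAvg_second_line`; main values at `t = P^z` from Z22:§10.u023/u024,
  `step10u023_holds`/`step10u024_holds`);
* `secondLine_main_eq_d7F`, `d7F_yyJ_eq` — `α⁻¹·(250000𝔞/log P)(∫₁ + ∫₂) = 𝔞·d7F j 𝔶𝔶₁ⱼ 𝔶𝔶₂ⱼ` EXACTLY
  (`α log P = π`), and `d7F j 𝔶𝔶₁ⱼ 𝔶𝔶₂ⱼ = d₇ⱼ` (`Section10Defs.d71/d72/d73`) for `j = 1, 2, 3`.

Theorem-only (0 definitions, 0 new facts). WHAT THIS IS NOT: a proof of the range claims u010/u011b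
themselves (those follow from Lemmas 10.1–10.2, `Section18RangeEdgesRelW`), of (18.3), of
Proposition 7.1, or of anything about Theorems 1–2 / Landau–Siegel zeros.

## References

* Y. Zhang, arXiv:2211.02515v1 (2022), §18 p. 100; §10 pp. 55–57 (Lemma 10.2, (10.9)–(10.10),
  u023–u024); §8 pp. 48–49; §2 (2.6), (2.10), (2.13), (2.31). [cite: Zhang2022LandauSiegel, §18 p.100]
-/

noncomputable section

open Complex Real ComplexConjugate MeasureTheory
open Literature.NumberTheory.LFunctions.Zhang2022.Skeleton

namespace Literature.NumberTheory.LFunctions.Zhang2022.Typed.Section18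

open Typed.Sec10C (lamAvg yyJ1 yyJ2)

/-! ## A. The §18 windows are `lamAvg` windows

The identities `main18u010 = 250000·L′²/log²P·lamAvg[P^{0.5},P^{0.502}]F₁` and its twin for
`main18u011b` are zl-w10-p1's `Section18MainSumsLamAvg` (`main18u010_eq_lamAvg`,
`main18u011b_eq_lamAvg`, p480942), imported. -/

/-! ## B. The two profiles are `C¹` on `[1, P]` with `‖F‖ ≪ 1`, `‖F′‖ ≪ α/t` -/

section Profiles

variable (c' : ℝ) {D : ℕ}

/-- **The linear factor `t ↦ −1 − β_j log(t/P^{0.5})` on `[1, P]`**: differentiable, `‖·‖ ≤ 17`,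
`‖d/dt‖ ≤ 4α/t` (`‖β_j‖ ≤ 4α`, `α|log(P^{0.5}/t)| ≤ α log P ≤ 4`). [cite: Zhang2022LandauSiegel, §18 p.100; §2 (2.13)] -/
theorem linFactor1_bounds (j : ℕ) {t : ℝ} (hα : 0 < alpha D) (hℓ : 0 ≤ ell D)
    (hc : 5 * |c'| * alpha D * ell D ≤ 1) (ht1 : 1 ≤ t) (htP : t ≤ bigP D)
    (hΛ4 : alpha D * Real.log (bigP D) ≤ 4) (hQ1 : 1 ≤ bigP D ^ (0.5 : ℝ))
    (hQP : bigP D ^ (0.5 : ℝ) ≤ bigP D) :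
    DifferentiableAt ℝ (fun u : ℝ => -1 - betaJ c' D j * (Real.log (u / bigP D ^ (0.5 : ℝ)) : ℂ)) t ∧
      ‖-1 - betaJ c' D j * (Real.log (t / bigP D ^ (0.5 : ℝ)) : ℂ)‖ ≤ 17 ∧
      ‖deriv (fun u : ℝ => -1 - betaJ c' D j * (Real.log (u / bigP D ^ (0.5 : ℝ)) : ℂ)) t‖ ≤
        4 * alpha D / t := by
  have ht : 0 < t := by linarith
  set Q : ℝ := bigP D ^ (0.5 : ℝ) with hQ
  have hQ0 : 0 < Q := by linarith
  set β : ℂ := betaJ c' D j with hβ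
  set g : ℂ → ℂ := fun L => -1 + β * L with hg
  -- `log(u/Q) = −log(Q/u)` near `t`
  have hfun : (fun u : ℝ => -1 - β * (Real.log (u / Q) : ℂ)) =ᶠ[nhds t]
      fun u => g ((Real.log (Q / u) : ℝ) : ℂ) := by
    filter_upwards [lt_mem_nhds ht] with u hu
    have : Real.log (u / Q) = -Real.log (Q / u) := by
      rw [Real.log_div hu.ne' hQ0.ne', Real.log_div hQ0.ne' hu.ne']; ring
    simp only [hg, this, Complex.ofReal_neg]; ring
  have hg' : ∀ L : ℂ, HasDerivAt g β L := by
    intro L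
    simpa [hg] using ((hasDerivAt_id L).const_mul β).const_add (-1)
  have hd0 : HasDerivAt (fun u : ℝ => g ((Real.log (Q / u) : ℝ) : ℂ)) (-β * (t : ℂ)⁻¹) t :=
    Section8AbelProfiles.hasDerivAt_comp_log_div hg' hQ0 ht
  have hd : HasDerivAt (fun u : ℝ => -1 - β * (Real.log (u / Q) : ℂ)) (-β * (t : ℂ)⁻¹) t :=
    hd0.congr_of_eventuallyEq hfun
  -- sizes
  have hL : |Real.log (Q / t)| ≤ Real.log (bigP D) :=
    Section8AbelProfiles.abs_log_div_le hQ1 hQP ht1 htP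
  have hβn : ‖β‖ ≤ 4 * alpha D := Section8AbelProfiles.norm_betaJ_le c' hα.le hℓ hc j
  have hval : ‖-1 - β * (Real.log (t / Q) : ℂ)‖ ≤ 17 := by
    have e : Real.log (t / Q) = -Real.log (Q / t) := by
      rw [Real.log_div ht.ne' hQ0.ne', Real.log_div hQ0.ne' ht.ne']; ring
    rw [e]
    calc ‖-1 - β * ((-Real.log (Q / t) : ℝ) : ℂ)‖ ≤ ‖(-1 : ℂ)‖ + ‖β * ((-Real.log (Q / t) : ℝ) : ℂ)‖ :=
          norm_sub_le _ _
      _ = 1 + ‖β‖ * |Real.log (Q / t)| := by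
          rw [norm_neg, norm_one, norm_mul, Complex.norm_real, Real.norm_eq_abs, abs_neg]
      _ ≤ 1 + 4 * alpha D * Real.log (bigP D) := by gcongr
      _ = 1 + 4 * (alpha D * Real.log (bigP D)) := by ring
      _ ≤ 1 + 4 * 4 := by gcongr
      _ = 17 := by norm_num
  refine ⟨hd.differentiableAt, hval, ?_⟩
  rw [hd.deriv, norm_mul, norm_neg, norm_inv, Complex.norm_real, Real.norm_eq_abs, abs_of_pos ht,
    ← div_eq_mul_inv]
  exact div_le_div_of_nonneg_right hβn ht.le

/-- **The linear factor `t ↦ 1 − β_j log(P^{0.504}/t)` on `[1, P]`**: differentiable, `‖·‖ ≤ 17`,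
`‖d/dt‖ ≤ 4α/t`. [cite: Zhang2022LandauSiegel, §18 p.100; §2 (2.13)] -/
theorem linFactor2_bounds (j : ℕ) {t : ℝ} (hα : 0 < alpha D) (hℓ : 0 ≤ ell D)
    (hc : 5 * |c'| * alpha D * ell D ≤ 1) (ht1 : 1 ≤ t) (htP : t ≤ bigP D)
    (hΛ4 : alpha D * Real.log (bigP D) ≤ 4) (hQ1 : 1 ≤ bigP D ^ (0.504 : ℝ))
    (hQP : bigP D ^ (0.504 : ℝ) ≤ bigP D) :
    DifferentiableAt ℝ (fun u : ℝ => 1 - betaJ c' D j * (Real.log (bigP D ^ (0.504 : ℝ) / u) : ℂ)) t ∧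
      ‖1 - betaJ c' D j * (Real.log (bigP D ^ (0.504 : ℝ) / t) : ℂ)‖ ≤ 17 ∧
      ‖deriv (fun u : ℝ => 1 - betaJ c' D j * (Real.log (bigP D ^ (0.504 : ℝ) / u) : ℂ)) t‖ ≤
        4 * alpha D / t := by
  have ht : 0 < t := by linarith
  set Q : ℝ := bigP D ^ (0.504 : ℝ) with hQ
  have hQ0 : 0 < Q := by linarith
  set β : ℂ := betaJ c' D j with hβ
  set g : ℂ → ℂ := fun L => 1 - β * L with hg
  have hfun : (fun u : ℝ => 1 - β * (Real.log (Q / u) : ℂ)) = fun u => g ((Real.log (Q / u) : ℝ) : ℂ) := by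
    funext u; simp only [hg]
  have hg' : ∀ L : ℂ, HasDerivAt g (-β) L := by
    intro L
    have h := ((hasDerivAt_id L).const_mul β).const_sub 1
    simpa [hg] using h
  have hd : HasDerivAt (fun u : ℝ => g ((Real.log (Q / u) : ℝ) : ℂ)) (-(-β) * (t : ℂ)⁻¹) t :=
    Section8AbelProfiles.hasDerivAt_comp_log_div hg' hQ0 ht
  have hL : |Real.log (Q / t)| ≤ Real.log (bigP D) :=
    Section8AbelProfiles.abs_log_div_le hQ1 hQP ht1 htP
  have hβn : ‖β‖ ≤ 4 * alpha D := Section8AbelProfiles.norm_betaJ_le c' hα.le hℓ hc j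
  have hval : ‖1 - β * (Real.log (Q / t) : ℂ)‖ ≤ 17 := by
    calc ‖1 - β * ((Real.log (Q / t) : ℝ) : ℂ)‖ ≤ ‖(1 : ℂ)‖ + ‖β * ((Real.log (Q / t) : ℝ) : ℂ)‖ :=
          norm_sub_le _ _
      _ = 1 + ‖β‖ * |Real.log (Q / t)| := by
          rw [norm_one, norm_mul, Complex.norm_real, Real.norm_eq_abs]
      _ ≤ 1 + 4 * alpha D * Real.log (bigP D) := by gcongr
      _ = 1 + 4 * (alpha D * Real.log (bigP D)) := by ring
      _ ≤ 1 + 4 * 4 := by gcongr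
      _ = 17 := by norm_num
  refine ⟨by rw [hfun]; exact hd.differentiableAt, hval, ?_⟩
  rw [hfun, hd.deriv, neg_neg, norm_mul, norm_inv, Complex.norm_real, Real.norm_eq_abs,
    abs_of_pos ht, ← div_eq_mul_inv]
  exact div_le_div_of_nonneg_right hβn ht.le

/-- Rescaling a `C¹` bound: if `u ↦ g(P^{0.004}u)` is differentiable at `u₀ = t/P^{0.004}` with
`‖g(P^{0.004}u₀)‖ ≤ A` and `‖(d/du)g(P^{0.004}u)|_{u₀}‖ ≤ B/u₀`, then `g` is differentiable at `t` with
`‖g(t)‖ ≤ A`, `‖g′(t)‖ ≤ B/t` (chain rule for the linear change of variable; used to move the tree's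
`y1Profile_bounds`/`y2Profile_bounds`, stated for `𝒴(P^{0.004}u)`, to `𝒴(t)`). [folklore] -/
private theorem scaled_bounds {g : ℝ → ℂ} {c t A B : ℝ} (hc : 0 < c) (ht : 0 < t)
    (h : DifferentiableAt ℝ (fun u : ℝ => g (c * u)) (t / c) ∧ ‖g (c * (t / c))‖ ≤ A ∧
      ‖deriv (fun u : ℝ => g (c * u)) (t / c)‖ ≤ B / (t / c)) :
    DifferentiableAt ℝ g t ∧ ‖g t‖ ≤ A ∧ ‖deriv g t‖ ≤ B / t := by
  obtain ⟨hd, hA, hB⟩ := h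
  have hct : c * (t / c) = t := mul_div_cancel₀ t hc.ne'
  set G : ℝ → ℂ := fun u : ℝ => g (c * u) with hG
  -- `g = G ∘ (· / c)`
  have hcomp : g = G ∘ fun s : ℝ => s / c := by
    funext s; simp only [hG, Function.comp_apply, mul_div_cancel₀ s hc.ne']
  have hlin : HasDerivAt (fun s : ℝ => s / c) (1 / c) t := by
    simpa using (hasDerivAt_id t).div_const c
  have hd' : HasDerivAt G (deriv G (t / c)) ((fun s : ℝ => s / c) t) := hd.hasDerivAt
  have hD : HasDerivAt (G ∘ fun s : ℝ => s / c) ((1 / c) • deriv G (t / c)) t :=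
    HasDerivAt.scomp (h := fun s : ℝ => s / c) t hd' hlin
  refine ⟨by rw [hcomp]; exact hD.differentiableAt, by rw [← hct]; exact hA, ?_⟩
  rw [hcomp, hD.deriv, norm_smul, Real.norm_eq_abs, abs_of_pos (by positivity : (0 : ℝ) < 1 / c)]
  have hB' : ‖deriv G (t / c)‖ ≤ B * c / t := by
    refine hB.trans (le_of_eq ?_)
    field_simp
  calc 1 / c * ‖deriv G (t / c)‖ ≤ 1 / c * (B * c / t) :=
        mul_le_mul_of_nonneg_left hB' (by positivity)
    _ = B / t := by field_simp


/-- **The factor `t ↦ −1 + 𝒴₁ⱼ(t)` on `[P^{0.004}, P^{1.004}]`**: differentiable, `‖·‖ ≤ 417`,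
`‖d/dt‖ ≤ 200α/t` — the tree's `Typed.Sec10C.y1Profile_bounds` (stated for `𝒴₁ⱼ(P^{0.004}u)`,
`u ∈ [1, P]`) moved to the variable `t = P^{0.004}u` (`scaled_bounds`).
[cite: Zhang2022LandauSiegel, §10 (10.9); §18 p.100] -/
theorem y1Factor_bounds (j : ℕ) {t : ℝ} (hα : 0 < alpha D) (hℓ : 0 ≤ ell D)
    (hc : 5 * |c'| * alpha D * ell D ≤ 1) (ht4 : bigP D ^ (0.004 : ℝ) ≤ t)
    (htP : t ≤ bigP D ^ (0.004 : ℝ) * bigP D) (hΛ4 : alpha D * Real.log (bigP D) ≤ 4) :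
    DifferentiableAt ℝ (fun u : ℝ => -1 + fraky1 c' D j u) t ∧ ‖-1 + fraky1 c' D j t‖ ≤ 417 ∧
      ‖deriv (fun u : ℝ => -1 + fraky1 c' D j u) t‖ ≤ 200 * alpha D / t := by
  have hc0 : 0 < bigP D ^ (0.004 : ℝ) := Real.rpow_pos_of_pos (Real.exp_pos _) _
  have ht : 0 < t := lt_of_lt_of_le hc0 ht4
  have hu1 : 1 ≤ t / bigP D ^ (0.004 : ℝ) := by rwa [le_div_iff₀ hc0, one_mul]
  have huP : t / bigP D ^ (0.004 : ℝ) ≤ bigP D := by rwa [div_le_iff₀ hc0, mul_comm]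
  exact scaled_bounds (g := fun u : ℝ => -1 + fraky1 c' D j u) hc0 ht
    (Typed.Sec10C.y1Profile_bounds c' j hα hℓ hc hu1 huP hΛ4)

/-- **The factor `t ↦ 1 + 𝒴₂ⱼ(t)` on `[P^{0.004}, P^{1.004}]`**: differentiable, `‖·‖ ≤ 161`,
`‖d/dt‖ ≤ 72α/t` (the tree's `Typed.Sec10C.y2Profile_bounds` moved to `t = P^{0.004}u`).
[cite: Zhang2022LandauSiegel, §10 (10.10); §18 p.100] -/
theorem y2Factor_bounds (j : ℕ) {t : ℝ} (hα : 0 < alpha D) (hℓ : 0 ≤ ell D)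
    (hc : 5 * |c'| * alpha D * ell D ≤ 1) (ht4 : bigP D ^ (0.004 : ℝ) ≤ t)
    (htP : t ≤ bigP D ^ (0.004 : ℝ) * bigP D) (hΛ4 : alpha D * Real.log (bigP D) ≤ 4)
    (hQ1 : 1 ≤ bigP D ^ (0.5 : ℝ)) (hQP : bigP D ^ (0.5 : ℝ) ≤ bigP D) :
    DifferentiableAt ℝ (fun u : ℝ => 1 + fraky2 c' D j u) t ∧ ‖1 + fraky2 c' D j t‖ ≤ 161 ∧
      ‖deriv (fun u : ℝ => 1 + fraky2 c' D j u) t‖ ≤ 72 * alpha D / t := by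
  have hc0 : 0 < bigP D ^ (0.004 : ℝ) := Real.rpow_pos_of_pos (Real.exp_pos _) _
  have ht : 0 < t := lt_of_lt_of_le hc0 ht4
  have hu1 : 1 ≤ t / bigP D ^ (0.004 : ℝ) := by rwa [le_div_iff₀ hc0, one_mul]
  have huP : t / bigP D ^ (0.004 : ℝ) ≤ bigP D := by rwa [div_le_iff₀ hc0, mul_comm]
  exact scaled_bounds (g := fun u : ℝ => 1 + fraky2 c' D j u) hc0 ht
    (Typed.Sec10C.y2Profile_bounds c' j hα hℓ hc hu1 huP hΛ4 hQ1 hQP)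

/-- The `P`-power facts used on the §18 windows (`𝓛 ≥ 2`): `1 ≤ P^{0.5} ≤ P`, `1 ≤ P^{0.504} ≤ P`,
`P^{0.004} ≤ P^{0.5}`, `P^{0.004} ≤ P^{0.502}`, `P^{0.502} + 1 ≤ P`, `P^{0.504} + 1 ≤ P`,
`1 ≤ P^{0.004}`, `P ≤ P^{0.004}·P` (`𝓛 ≥ 3`). [cite: Zhang2022LandauSiegel, §2 (2.6)] -/
theorem window_facts (hℓ : 3 ≤ ell D) :
    (1 ≤ bigP D ^ (0.5 : ℝ) ∧ bigP D ^ (0.5 : ℝ) ≤ bigP D) ∧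
      (1 ≤ bigP D ^ (0.504 : ℝ) ∧ bigP D ^ (0.504 : ℝ) ≤ bigP D) ∧
      (bigP D ^ (0.004 : ℝ) ≤ bigP D ^ (0.5 : ℝ) ∧ bigP D ^ (0.004 : ℝ) ≤ bigP D ^ (0.502 : ℝ)) ∧
      (bigP D ^ (0.502 : ℝ) + 1 ≤ bigP D ∧ bigP D ^ (0.504 : ℝ) + 1 ≤ bigP D) ∧
      (1 ≤ bigP D ^ (0.004 : ℝ) ∧ bigP D ≤ bigP D ^ (0.004 : ℝ) * bigP D) := by
  have hℓ0 : 0 < ell D := by linarith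
  have hℓ1 : 1 ≤ ell D := by linarith
  have hP1 : 1 < bigP D := by rw [bigP]; exact Real.one_lt_exp_iff.2 (pow_pos hℓ0 9)
  have h1 : 1 ≤ bigP D ^ (0.004 : ℝ) := Real.one_le_rpow hP1.le (by norm_num)
  refine ⟨Typed.Sec10C.rpow_window hP1.le (by norm_num) (by norm_num),
    Typed.Sec10C.rpow_window hP1.le (by norm_num) (by norm_num),
    ⟨Real.rpow_le_rpow_of_exponent_le hP1.le (by norm_num),
      Real.rpow_le_rpow_of_exponent_le hP1.le (by norm_num)⟩,
    ⟨Typed.Sec10C.rpow_add_one_le_bigP (by norm_num) (by norm_num) hℓ1 (by norm_num; linarith),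
      Typed.Sec10C.rpow_add_one_le_bigP (by norm_num) (by norm_num) hℓ1 (by norm_num; linarith)⟩,
    h1, ?_⟩
  calc bigP D = 1 * bigP D := (one_mul _).symm
    _ ≤ bigP D ^ (0.004 : ℝ) * bigP D := mul_le_mul_of_nonneg_right h1 (by linarith)

/-- **The second-range profile `F₁(t) = (−1 − β_j log(t/P^{0.5}))(−1 + 𝒴₁ⱼ(t))` on `[P^{0.5}, P]`**:
differentiable, `‖F₁‖ ≤ 7089`, `‖F₁′‖ ≤ 5068α/t` (`17·417`; `4·417 + 17·200`), given `5|c′|α𝓛 ≤ 1`,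
`α log P ≤ 4`, `𝓛 ≥ 3`. [cite: Zhang2022LandauSiegel, §18 p.100] -/
theorem profile1_bounds (j : ℕ) {t : ℝ} (hα : 0 < alpha D) (hℓ : 3 ≤ ell D)
    (hc : 5 * |c'| * alpha D * ell D ≤ 1) (hΛ4 : alpha D * Real.log (bigP D) ≤ 4)
    (ht1 : bigP D ^ (0.5 : ℝ) ≤ t) (htP : t ≤ bigP D) :
    DifferentiableAt ℝ (fun u : ℝ => (-1 - betaJ c' D j * (Real.log (u / bigP D ^ (0.5 : ℝ)) : ℂ)) *
        (-1 + fraky1 c' D j u)) t ∧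
      ‖(-1 - betaJ c' D j * (Real.log (t / bigP D ^ (0.5 : ℝ)) : ℂ)) * (-1 + fraky1 c' D j t)‖ ≤ 7089 ∧
      ‖deriv (fun u : ℝ => (-1 - betaJ c' D j * (Real.log (u / bigP D ^ (0.5 : ℝ)) : ℂ)) *
        (-1 + fraky1 c' D j u)) t‖ ≤ 5068 * alpha D / t := by
  obtain ⟨⟨hQ1, hQP⟩, -, ⟨h45, -⟩, -, -, hPP⟩ := window_facts hℓ
  have hℓ0 : 0 ≤ ell D := by linarith
  have h1t : 1 ≤ t := hQ1.trans ht1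
  obtain ⟨hfd, hfn, hfd'⟩ := linFactor1_bounds c' j hα hℓ0 hc h1t htP hΛ4 hQ1 hQP
  obtain ⟨hgd, hgn, hgd'⟩ := y1Factor_bounds c' j hα hℓ0 hc (h45.trans ht1) (htP.trans hPP) hΛ4
  obtain ⟨h1, h2, h3⟩ := Section8AbelProfiles.mul_bounds hfd hgd hfn hgn hfd' hgd' (by norm_num)
  refine ⟨h1, h2.trans (by norm_num), h3.trans (le_of_eq ?_)⟩
  ring

/-- **The third-range profile `F₂(t) = (1 − β_j log(P^{0.504}/t))(1 + 𝒴₂ⱼ(t))` on `[P^{0.502}, P]`**: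
differentiable, `‖F₂‖ ≤ 2737`, `‖F₂′‖ ≤ 1868α/t` (`17·161`; `4·161 + 17·72`).
[cite: Zhang2022LandauSiegel, §18 p.100; §10 (10.10)] -/
theorem profile2_bounds (j : ℕ) {t : ℝ} (hα : 0 < alpha D) (hℓ : 3 ≤ ell D)
    (hc : 5 * |c'| * alpha D * ell D ≤ 1) (hΛ4 : alpha D * Real.log (bigP D) ≤ 4)
    (ht1 : bigP D ^ (0.502 : ℝ) ≤ t) (htP : t ≤ bigP D) :
    DifferentiableAt ℝ (fun u : ℝ => (1 - betaJ c' D j * (Real.log (bigP D ^ (0.504 : ℝ) / u) : ℂ)) *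
        (1 + fraky2 c' D j u)) t ∧
      ‖(1 - betaJ c' D j * (Real.log (bigP D ^ (0.504 : ℝ) / t) : ℂ)) * (1 + fraky2 c' D j t)‖ ≤ 2737 ∧
      ‖deriv (fun u : ℝ => (1 - betaJ c' D j * (Real.log (bigP D ^ (0.504 : ℝ) / u) : ℂ)) *
        (1 + fraky2 c' D j u)) t‖ ≤ 1868 * alpha D / t := by
  obtain ⟨⟨hQ1, hQP⟩, ⟨hR1, hRP⟩, ⟨-, h452⟩, -, h41, hPP⟩ := window_facts hℓ
  have hℓ0 : 0 ≤ ell D := by linarith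
  have h4t : bigP D ^ (0.004 : ℝ) ≤ t := h452.trans ht1
  have h1t : 1 ≤ t := h41.trans h4t
  obtain ⟨hfd, hfn, hfd'⟩ := linFactor2_bounds c' j hα hℓ0 hc h1t htP hΛ4 hR1 hRP
  obtain ⟨hgd, hgn, hgd'⟩ := y2Factor_bounds c' j hα hℓ0 hc h4t (htP.trans hPP) hΛ4 hQ1 hQP
  obtain ⟨h1, h2, h3⟩ := Section8AbelProfiles.mul_bounds hfd hgd hfn hgn hfd' hgd' (by norm_num)
  refine ⟨h1, h2.trans (by norm_num), h3.trans (le_of_eq ?_)⟩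
  ring

end Profiles

/-! ## C. The second lines: `main18u010`, `main18u011b` pass to their `z`-integrals -/

section SecondLines

/-- `‖−1 − πij·w‖ ≤ 2` and `‖1 − πij·w‖ ≤ 2` for `j ≤ 3`, `|w| ≤ 0.002`. [folklore] -/
private theorem norm_linMain_le {j : ℕ} (hj : j ∈ ({1, 2, 3} : Finset ℕ)) {w : ℝ} (hw : |w| ≤ 0.002) :
    ‖-1 - π * I * j * (w : ℂ)‖ ≤ 2 ∧ ‖1 - π * I * j * (w : ℂ)‖ ≤ 2 := by
  have hj3 : (j : ℝ) ≤ 3 := by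
    simp only [Finset.mem_insert, Finset.mem_singleton] at hj
    rcases hj with rfl | rfl | rfl <;> norm_num
  have hπ := Real.pi_lt_d2
  have hm : ‖(π : ℂ) * I * j * (w : ℂ)‖ ≤ 1 := by
    rw [norm_mul, norm_mul, norm_mul, Complex.norm_real, Complex.norm_I, mul_one, Complex.norm_natCast,
      Complex.norm_real, Real.norm_eq_abs, Real.norm_eq_abs, abs_of_pos Real.pi_pos]
    calc π * (j : ℝ) * |w| ≤ 3.15 * 3 * 0.002 := by
          gcongr
      _ ≤ 1 := by norm_num
  constructor
  · calc ‖-1 - (π : ℂ) * I * j * (w : ℂ)‖ ≤ ‖(-1 : ℂ)‖ + ‖(π : ℂ) * I * j * (w : ℂ)‖ := norm_sub_le _ _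
      _ ≤ 1 + 1 := by rw [norm_neg, norm_one]; gcongr
      _ = 2 := by norm_num
  · calc ‖1 - (π : ℂ) * I * j * (w : ℂ)‖ ≤ ‖(1 : ℂ)‖ + ‖(π : ℂ) * I * j * (w : ℂ)‖ := norm_sub_le _ _
      _ ≤ 1 + 1 := by rw [norm_one]; gcongr
      _ = 2 := by norm_num

/-- **§18 p.100, second range, SECOND LINE** (Z22 tex L4932–L4937 with the §10 evaluation rule
"By the discussion in Section 8 and 10"): for every `ε > 0`, all large `D`, every real primitive `χ`
satisfying (A) and `j ∈ {1,2,3}`,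
`‖main18u010 − (250000𝔞/log P)∫_{0.5}^{0.502}(−1 − πij(z − 0.5))(−1 + 𝔶𝔶₁ⱼ(z))dz‖ ≤ εα`.
Route: `main18u010 = 250000L′²/log²P·lamAvg[P^{0.5},P^{0.502}]F₁` (`main18u010_eq_lamAvg`, zl-w10-p1),
`Typed.Sec10C.lamAvg_second_line` with the profile bounds `profile1_bounds`, and the main values at
`t = P^z`: `β_j log(P^{z−0.5}) = πij(z−0.5) + O(𝓛⁻⁸)` (Z22:§10.u023, `Typed.Sec10A.step10u023_holds`),
`𝒴₁ⱼ(P^z) = 𝔶𝔶₁ⱼ(z) + O(𝓛⁻⁸)` (Z22:§10.u024, `step10u024_holds`) — (A) enters only through these two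
tree theorems, typed under (A). Error `O_{c′}(𝓛⁻¹²) ≤ εα`. [cite: Zhang2022LandauSiegel, §18 p.100; §10 p.56] -/
theorem main18u010_secondLine (c' : ℝ) :
    ∀ ε : ℝ, 0 < ε → ForAllLarge fun D _ χ => AssumptionA D χ → ∀ j ∈ ({1, 2, 3} : Finset ℕ),
      ‖main18u010 c' χ j - 250000 * (frakA χ : ℂ) / (Real.log (bigP D) : ℂ) *
          ∫ z in (0.5 : ℝ)..0.502, (-1 - π * I * j * ((z - 0.5 : ℝ) : ℂ)) * (-1 + yyJ1 j z)‖ ≤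
        ε * alpha D := by
  intro ε hε
  obtain ⟨C₂₃, h23⟩ := Sec10A.step10u023_holds c'
  obtain ⟨C₂₄, h24⟩ := Sec10A.step10u024_holds c'
  set C₀ : ℝ := 417 * |C₂₃| + 2 * |C₂₄| with hC₀
  have hC₀0 : 0 ≤ C₀ := by positivity
  have hgen := Typed.Sec10C.lamAvg_second_line c' (250000 : ℂ) (a := 0.5) (b := 0.502) (M := 7089)
    (M' := 5068) (C₀ := C₀) (by norm_num) (by norm_num) (by norm_num) (by norm_num) (by norm_num)
    hC₀0 ε hε
  have h5 := Typed.Sec10C.forAllLarge_ell_six (5 * c')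
  refine (((hgen.and h23).and h24).and h5).mono ?_
  intro D _ χ hq hp ⟨⟨⟨hG, h23D⟩, h24D⟩, hℓ6, hc5⟩ hA j hj
  -- parameters
  have hℓ0 : 0 < ell D := by linarith
  have hℓ3 : 3 ≤ ell D := by linarith
  have hP : 0 < bigP D := Real.exp_pos _
  have hP1 : 1 < bigP D := by rw [bigP]; exact Real.one_lt_exp_iff.2 (pow_pos hℓ0 9)
  have hlogP : Real.log (bigP D) = ell D ^ 9 := by rw [bigP, Real.log_exp]
  have hΛ : 0 < Real.log (bigP D) := by rw [hlogP]; positivity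
  have hα : 0 < alpha D := Typed.Sec10C.alpha_pos hΛ
  have hΛ4 : alpha D * Real.log (bigP D) ≤ 4 := by
    rw [alpha, div_mul_cancel₀ _ hΛ.ne']; linarith [Real.pi_lt_d2]
  have hc : 5 * |c'| * alpha D * ell D ≤ 1 := by
    have : |5 * c'| = 5 * |c'| := by rw [abs_mul, abs_of_pos (by norm_num : (0:ℝ) < 5)]
    rw [this] at hc5; linarith [hc5]
  obtain ⟨⟨hQ1, hQP⟩, -, ⟨h45, -⟩, ⟨h502P, -⟩, h41, hPP⟩ := window_facts (D := D) hℓ3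
  -- the profile and its main value
  set F : ℝ → ℂ := fun t => (-1 - betaJ c' D j * (Real.log (t / bigP D ^ (0.5 : ℝ)) : ℂ)) *
    (-1 + fraky1 c' D j t) with hF
  set G₀ : ℝ → ℂ := fun z => (-1 - π * I * j * ((z - 0.5 : ℝ) : ℂ)) * (-1 + yyJ1 j z) with hG₀
  have hprof : ∀ t : ℝ, bigP D ^ (0.5 : ℝ) ≤ t → t ≤ bigP D ^ (0.502 : ℝ) + 1 →
      DifferentiableAt ℝ F t ∧ ‖F t‖ ≤ 7089 ∧ ‖deriv F t‖ ≤ 5068 * alpha D / t := by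
    intro t h1 h2
    exact profile1_bounds c' j hα hℓ3 hc hΛ4 h1 (h2.trans h502P)
  have hG₀i : IntervalIntegrable G₀ volume (0.5 : ℝ) 0.502 := by
    apply Continuous.intervalIntegrable
    rw [hG₀]
    fun_prop
  have happrox : ∀ z ∈ Set.Icc (0.5 : ℝ) 0.502, ‖F (bigP D ^ z) - G₀ z‖ ≤ C₀ / ell D ^ 8 := by
    intro z hz
    obtain ⟨hz1, hz2⟩ := hz
    have hz0 : (0 : ℝ) ≤ z := by linarith
    have hz1' : z ≤ (1 : ℝ) := by linarith
    set a : ℂ := -1 - betaJ c' D j * (Real.log (bigP D ^ z / bigP D ^ (0.5 : ℝ)) : ℂ) with ha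
    set b : ℂ := -1 + fraky1 c' D j (bigP D ^ z) with hb
    set a₀ : ℂ := -1 - π * I * j * ((z - 0.5 : ℝ) : ℂ) with ha₀
    set b₀ : ℂ := -1 + yyJ1 j z with hb₀
    have eF : F (bigP D ^ z) - G₀ z = (a - a₀) * b + a₀ * (b - b₀) := by
      simp only [hF, hG₀, ha, hb, ha₀, hb₀]; ring
    -- `‖a − a₀‖ ≤ |C₂₃|𝓛⁻⁸` (Z22:§10.u023)
    have haa : ‖a - a₀‖ ≤ |C₂₃| / ell D ^ 8 := by
      have h := (h23D hA j hj z hz0 hz1').1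
      have ediv : bigP D ^ z / bigP D ^ (0.5 : ℝ) = bigP D ^ (z - 0.5) := (Real.rpow_sub hP z 0.5).symm
      have e : a - a₀ = -(betaJ c' D j * (Real.log (bigP D ^ (z - 0.5)) : ℂ) -
          π * I * j * ((z - 0.5 : ℝ) : ℂ)) := by
        rw [ha, ha₀, ediv]; ring
      rw [e, norm_neg]
      refine h.trans ?_
      rw [← div_eq_mul_inv]
      gcongr
      exact le_abs_self _
    -- `‖b‖ ≤ 417`
    have hbn : ‖b‖ ≤ 417 := by
      have h4z : bigP D ^ (0.004 : ℝ) ≤ bigP D ^ z := Real.rpow_le_rpow_of_exponent_le hP1.le (by linarith)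
      have hzP : bigP D ^ z ≤ bigP D ^ (0.004 : ℝ) * bigP D := by
        calc bigP D ^ z ≤ bigP D ^ (1 : ℝ) := Real.rpow_le_rpow_of_exponent_le hP1.le hz1'
          _ = bigP D := Real.rpow_one _
          _ ≤ bigP D ^ (0.004 : ℝ) * bigP D := hPP
      exact (y1Factor_bounds c' j hα hℓ0.le hc h4z hzP hΛ4).2.1
    -- `‖a₀‖ ≤ 2`
    have ha₀n : ‖a₀‖ ≤ 2 :=
      (norm_linMain_le hj (w := z - 0.5) (by rw [abs_le]; constructor <;> linarith)).1
    -- `‖b − b₀‖ ≤ |C₂₄|𝓛⁻⁸` (Z22:§10.u024)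
    have hbb : ‖b - b₀‖ ≤ |C₂₄| / ell D ^ 8 := by
      have h := (h24D hA j hj z hz0 hz1').1
      have e : b - b₀ = fraky1 c' D j (bigP D ^ z) -
          (if j = 1 then yy11 z else if j = 2 then yy12 z else yy13 z) := by
        rw [hb, hb₀, Typed.Sec10C.yyJ1_apply]; ring
      rw [e]
      refine h.trans ?_
      rw [← div_eq_mul_inv]
      gcongr
      exact le_abs_self _
    rw [eF]
    calc ‖(a - a₀) * b + a₀ * (b - b₀)‖ ≤ ‖a - a₀‖ * ‖b‖ + ‖a₀‖ * ‖b - b₀‖ := by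
          refine (norm_add_le _ _).trans ?_; rw [norm_mul, norm_mul]
      _ ≤ |C₂₃| / ell D ^ 8 * 417 + 2 * (|C₂₄| / ell D ^ 8) :=
          add_le_add (mul_le_mul haa hbn (norm_nonneg _) (by positivity))
            (mul_le_mul ha₀n hbb (norm_nonneg _) (by norm_num))
      _ = C₀ / ell D ^ 8 := by rw [hC₀]; ring
  -- the engine
  have key := hG j F G₀ hprof hG₀i happrox
  have eS : main18u010 c' χ j = 250000 * deriv χ.LFunction 1 ^ 2 / (Real.log (bigP D) : ℂ) ^ 2 *
      lamAvg c' χ j (bigP D ^ (0.5 : ℝ)) (bigP D ^ (0.502 : ℝ)) (fun n => F n) := by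
    rw [main18u010_eq_lamAvg c' χ (by linarith) j]
  rw [eS]
  exact key

/-- **§18 p.100, third range (reading `𝒴₂ⱼ`), SECOND LINE** (Z22 tex L4938–L4942; (10.10)): for every
`ε > 0`, all large `D`, (A), `j ∈ {1,2,3}`:
`‖main18u011b − (250000𝔞/log P)∫_{0.502}^{0.504}(1 − πij(0.504 − z))(1 + 𝔶𝔶₂ⱼ(z))dz‖ ≤ εα`
(`lamAvg_second_line` on `[P^{0.502}, P^{0.504}]` with `profile2_bounds`; main values at `P^z` by
Z22:§10.u023 (second clause) and Z22:§10.u024 (second clause)).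
[cite: Zhang2022LandauSiegel, §18 p.100; §10 (10.10), p.56] -/
theorem main18u011b_secondLine (c' : ℝ) :
    ∀ ε : ℝ, 0 < ε → ForAllLarge fun D _ χ => AssumptionA D χ → ∀ j ∈ ({1, 2, 3} : Finset ℕ),
      ‖main18u011b c' χ j - 250000 * (frakA χ : ℂ) / (Real.log (bigP D) : ℂ) *
          ∫ z in (0.502 : ℝ)..0.504, (1 - π * I * j * ((0.504 - z : ℝ) : ℂ)) * (1 + yyJ2 j z)‖ ≤
        ε * alpha D := by
  intro ε hε
  obtain ⟨C₂₃, h23⟩ := Sec10A.step10u023_holds c'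
  obtain ⟨C₂₄, h24⟩ := Sec10A.step10u024_holds c'
  set C₀ : ℝ := 161 * |C₂₃| + 2 * |C₂₄| with hC₀
  have hC₀0 : 0 ≤ C₀ := by positivity
  have hgen := Typed.Sec10C.lamAvg_second_line c' (250000 : ℂ) (a := 0.502) (b := 0.504) (M := 2737)
    (M' := 1868) (C₀ := C₀) (by norm_num) (by norm_num) (by norm_num) (by norm_num) (by norm_num)
    hC₀0 ε hε
  have h5 := Typed.Sec10C.forAllLarge_ell_six (5 * c')
  refine (((hgen.and h23).and h24).and h5).mono ?_
  intro D _ χ hq hp ⟨⟨⟨hG, h23D⟩, h24D⟩, hℓ6, hc5⟩ hA j hj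
  -- parameters
  have hℓ0 : 0 < ell D := by linarith
  have hℓ3 : 3 ≤ ell D := by linarith
  have hP : 0 < bigP D := Real.exp_pos _
  have hP1 : 1 < bigP D := by rw [bigP]; exact Real.one_lt_exp_iff.2 (pow_pos hℓ0 9)
  have hlogP : Real.log (bigP D) = ell D ^ 9 := by rw [bigP, Real.log_exp]
  have hΛ : 0 < Real.log (bigP D) := by rw [hlogP]; positivity
  have hα : 0 < alpha D := Typed.Sec10C.alpha_pos hΛ
  have hΛ4 : alpha D * Real.log (bigP D) ≤ 4 := by
    rw [alpha, div_mul_cancel₀ _ hΛ.ne']; linarith [Real.pi_lt_d2]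
  have hc : 5 * |c'| * alpha D * ell D ≤ 1 := by
    have : |5 * c'| = 5 * |c'| := by rw [abs_mul, abs_of_pos (by norm_num : (0:ℝ) < 5)]
    rw [this] at hc5; linarith [hc5]
  obtain ⟨⟨hQ1, hQP⟩, -, ⟨-, h452⟩, ⟨-, h504P⟩, h41, hPP⟩ := window_facts (D := D) hℓ3
  -- the profile and its main value
  set F : ℝ → ℂ := fun t => (1 - betaJ c' D j * (Real.log (bigP D ^ (0.504 : ℝ) / t) : ℂ)) *
    (1 + fraky2 c' D j t) with hF
  set G₀ : ℝ → ℂ := fun z => (1 - π * I * j * ((0.504 - z : ℝ) : ℂ)) * (1 + yyJ2 j z) with hG₀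
  have hprof : ∀ t : ℝ, bigP D ^ (0.502 : ℝ) ≤ t → t ≤ bigP D ^ (0.504 : ℝ) + 1 →
      DifferentiableAt ℝ F t ∧ ‖F t‖ ≤ 2737 ∧ ‖deriv F t‖ ≤ 1868 * alpha D / t := by
    intro t h1 h2
    exact profile2_bounds c' j hα hℓ3 hc hΛ4 h1 (h2.trans h504P)
  have hG₀i : IntervalIntegrable G₀ volume (0.502 : ℝ) 0.504 := by
    apply Continuous.intervalIntegrable
    rw [hG₀]
    fun_prop
  have happrox : ∀ z ∈ Set.Icc (0.502 : ℝ) 0.504, ‖F (bigP D ^ z) - G₀ z‖ ≤ C₀ / ell D ^ 8 := by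
    intro z hz
    obtain ⟨hz1, hz2⟩ := hz
    have hz0 : (0 : ℝ) ≤ z := by linarith
    have hz1' : z ≤ (1 : ℝ) := by linarith
    set a : ℂ := 1 - betaJ c' D j * (Real.log (bigP D ^ (0.504 : ℝ) / bigP D ^ z) : ℂ) with ha
    set b : ℂ := 1 + fraky2 c' D j (bigP D ^ z) with hb
    set a₀ : ℂ := 1 - π * I * j * ((0.504 - z : ℝ) : ℂ) with ha₀
    set b₀ : ℂ := 1 + yyJ2 j z with hb₀
    have eF : F (bigP D ^ z) - G₀ z = (a - a₀) * b + a₀ * (b - b₀) := by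
      simp only [hF, hG₀, ha, hb, ha₀, hb₀]; ring
    -- `‖a − a₀‖ ≤ |C₂₃|𝓛⁻⁸` (Z22:§10.u023, second clause)
    have haa : ‖a - a₀‖ ≤ |C₂₃| / ell D ^ 8 := by
      have h := (h23D hA j hj z hz0 hz1').2
      have ediv : bigP D ^ (0.504 : ℝ) / bigP D ^ z = bigP D ^ ((0.504 : ℝ) - z) :=
        (Real.rpow_sub hP 0.504 z).symm
      have e : a - a₀ = -(betaJ c' D j * (Real.log (bigP D ^ ((0.504 : ℝ) - z)) : ℂ) -
          π * I * j * ((0.504 - z : ℝ) : ℂ)) := by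
        rw [ha, ha₀, ediv]; ring
      rw [e, norm_neg]
      refine h.trans ?_
      rw [← div_eq_mul_inv]
      gcongr
      exact le_abs_self _
    -- `‖b‖ ≤ 161`
    have hbn : ‖b‖ ≤ 161 := by
      have h4z : bigP D ^ (0.004 : ℝ) ≤ bigP D ^ z := Real.rpow_le_rpow_of_exponent_le hP1.le (by linarith)
      have hzP : bigP D ^ z ≤ bigP D ^ (0.004 : ℝ) * bigP D := by
        calc bigP D ^ z ≤ bigP D ^ (1 : ℝ) := Real.rpow_le_rpow_of_exponent_le hP1.le hz1'
          _ = bigP D := Real.rpow_one _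
          _ ≤ bigP D ^ (0.004 : ℝ) * bigP D := hPP
      exact (y2Factor_bounds c' j hα hℓ0.le hc h4z hzP hΛ4 hQ1 hQP).2.1
    -- `‖a₀‖ ≤ 2`
    have ha₀n : ‖a₀‖ ≤ 2 :=
      (norm_linMain_le hj (w := 0.504 - z) (by rw [abs_le]; constructor <;> linarith)).2
    -- `‖b − b₀‖ ≤ |C₂₄|𝓛⁻⁸` (Z22:§10.u024, second clause)
    have hbb : ‖b - b₀‖ ≤ |C₂₄| / ell D ^ 8 := by
      have h := (h24D hA j hj z hz0 hz1').2
      have e : b - b₀ = fraky2 c' D j (bigP D ^ z) -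
          (if j = 1 then yy21 z else if j = 2 then yy22 z else yy23 z) := by
        rw [hb, hb₀, Typed.Sec10C.yyJ2_apply]; ring
      rw [e]
      refine h.trans ?_
      rw [← div_eq_mul_inv]
      gcongr
      exact le_abs_self _
    rw [eF]
    calc ‖(a - a₀) * b + a₀ * (b - b₀)‖ ≤ ‖a - a₀‖ * ‖b‖ + ‖a₀‖ * ‖b - b₀‖ := by
          refine (norm_add_le _ _).trans ?_; rw [norm_mul, norm_mul]
      _ ≤ |C₂₃| / ell D ^ 8 * 161 + 2 * (|C₂₄| / ell D ^ 8) :=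
          add_le_add (mul_le_mul haa hbn (norm_nonneg _) (by positivity))
            (mul_le_mul ha₀n hbb (norm_nonneg _) (by norm_num))
      _ = C₀ / ell D ^ 8 := by rw [hC₀]; ring
  -- the engine
  have key := hG j F G₀ hprof hG₀i happrox
  have eS : main18u011b c' χ j = 250000 * deriv χ.LFunction 1 ^ 2 / (Real.log (bigP D) : ℂ) ^ 2 *
      lamAvg c' χ j (bigP D ^ (0.502 : ℝ)) (bigP D ^ (0.504 : ℝ)) (fun n => F n) := by
    rw [main18u011b_eq_lamAvg c' χ (by linarith) j]
  rw [eS]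
  exact key

end SecondLines

/-! ## D. The main term: `α⁻¹·(250000𝔞/log P)(∫₁ + ∫₂) = 𝔞·d₇ⱼ` -/

section MainTerm

/-- **`α⁻¹·(250000𝔞/log P)(∫₁ + ∫₂) = 𝔞·d7F j 𝔶𝔶₁ⱼ 𝔶𝔶₂ⱼ` EXACTLY** (`α log P = π`, so
`250000/(α log P) = 500²/π`, the prefactor of `Section10Defs.d7F`; the integrands are those of `d7F`).
[cite: Zhang2022LandauSiegel, §18 proof of (2.33); §2 (2.10)] -/
theorem secondLine_main_eq_d7F {D : ℕ} [NeZero D] (χ : DirichletCharacter ℂ D) (j : ℕ)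
    (hΛ : 0 < Real.log (bigP D)) :
    (alpha D : ℂ)⁻¹ *
        (250000 * (frakA χ : ℂ) / (Real.log (bigP D) : ℂ) *
            (∫ z in (0.5 : ℝ)..0.502, (-1 - π * I * j * ((z - 0.5 : ℝ) : ℂ)) * (-1 + yyJ1 j z)) +
          250000 * (frakA χ : ℂ) / (Real.log (bigP D) : ℂ) *
            ∫ z in (0.502 : ℝ)..0.504, (1 - π * I * j * ((0.504 - z : ℝ) : ℂ)) * (1 + yyJ2 j z)) =
      (frakA χ : ℂ) * d7F j (yyJ1 j) (yyJ2 j) := by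
  have hΛ0 : (Real.log (bigP D) : ℂ) ≠ 0 := by exact_mod_cast hΛ.ne'
  have hπ0 : (π : ℂ) ≠ 0 := by exact_mod_cast Real.pi_ne_zero
  have hα : (alpha D : ℂ)⁻¹ = (Real.log (bigP D) : ℂ) / π := by
    rw [alpha, Complex.ofReal_div, inv_div]
  have e1 : (∫ z in (0.5 : ℝ)..0.502, (-1 - π * I * j * ((z - 0.5 : ℝ) : ℂ)) * (-1 + yyJ1 j z)) =
      ∫ z in (0.5 : ℝ)..0.502, (-1 - (j : ℂ) * π * I * (z - 0.5)) * (-1 + yyJ1 j z) :=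
    intervalIntegral.integral_congr fun z _ => by push_cast; ring
  have e2 : (∫ z in (0.502 : ℝ)..0.504, (1 - π * I * j * ((0.504 - z : ℝ) : ℂ)) * (1 + yyJ2 j z)) =
      ∫ z in (0.502 : ℝ)..0.504, (1 - (j : ℂ) * π * I * (0.504 - z)) * (1 + yyJ2 j z) :=
    intervalIntegral.integral_congr fun z _ => by push_cast; ring
  rw [e1, e2, hα]
  unfold d7F
  push_cast
  field_simp
  ring

/-- `d7F j 𝔶𝔶₁ⱼ 𝔶𝔶₂ⱼ` is the printed `d₇ⱼ` (`Section10Defs.d71`, `d72`, `d73`) for `j = 1, 2, 3`.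
[cite: Zhang2022LandauSiegel, §18 proof of (2.33); §10 p.57] -/
theorem d7F_yyJ_eq :
    d7F 1 (yyJ1 1) (yyJ2 1) = d71 ∧ d7F 2 (yyJ1 2) (yyJ2 2) = d72 ∧ d7F 3 (yyJ1 3) (yyJ2 3) = d73 := by
  have e11 : yyJ1 1 = yy11 := by funext w; rw [Typed.Sec10C.yyJ1_apply]; simp
  have e12 : yyJ1 2 = yy12 := by funext w; rw [Typed.Sec10C.yyJ1_apply]; simp
  have e13 : yyJ1 3 = yy13 := by funext w; rw [Typed.Sec10C.yyJ1_apply]; simp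
  have e21 : yyJ2 1 = yy21 := by funext w; rw [Typed.Sec10C.yyJ2_apply]; simp
  have e22 : yyJ2 2 = yy22 := by funext w; rw [Typed.Sec10C.yyJ2_apply]; simp
  have e23 : yyJ2 3 = yy23 := by funext w; rw [Typed.Sec10C.yyJ2_apply]; simp
  rw [e11, e12, e13, e21, e22, e23]
  exact ⟨rfl, rfl, rfl⟩

/-- **The weighted combination is `C₂₃₃`**: `2Re{½·d7F 1 + 2·d7F 2 + 3⁄2·d7F 3} = C233` at the printed
profiles `𝔶𝔶`. [cite: Zhang2022LandauSiegel, (18.3), (2.33)] -/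
theorem combination_d7F_re_eq_C233 :
    2 * (1 / 2 * d7F 1 (yyJ1 1) (yyJ2 1) + 2 * d7F 2 (yyJ1 2) (yyJ2 2) +
      3 / 2 * d7F 3 (yyJ1 3) (yyJ2 3)).re = C233 := by
  obtain ⟨e1, e2, e3⟩ := d7F_yyJ_eq
  rw [e1, e2, e3]
  rfl

end MainTerm

end Literature.NumberTheory.LFunctions.Zhang2022.Typed.Section18
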